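/-
Copyright (c) 2026 the pub-hodgecm-mathlib formalisation cell (harness21).  Prover seat hodgecm-mathlib-K2E5-p10 (g4), Track B «K2-LIT» ∕ h413
(`stmt-HodgeConjecture-24833`), line `K2_E3_EllipticInputs`, unit U12, §L road «U-iso-T» brick (G⁺-b)/(K4-b1): UNIFORM BOUNDS FOR THE TRUNCATED QUADRATIC-
CHARACTER WEIGHT — the model annulus `|∫_{𝔭^a∖𝔭^b} χ̃‖·‖⁻¹| ≤ μ(𝒪)`, the localised ball, the LINEAR and the ELLIPTIC cell integrals.  2026-09-04.
-/
import Summits.HodgeConjecture.HodgeConjecture.Theorems.K2E3LocalFieldQuadraticWeightEventuallyConst   -- ★ (this seat): (K4-a) kit, (K4-S), (K4-E)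
import HarnessLib

/-!
# K2_E3 road (h413), §L brick (G⁺-b)/(K4-b1) — uniform bounds for the truncated quadratic-character weight, I

Cell `pub/hodgecm-mathlib` (D-0151), Track B, seat K2E5-p10 (g4) (E3 §L line; dealer K2E3-plan (g3); (G⁺-b): line side K2E5-p17 (g3) ★, `K`-side this seat).
`--supports stmt-HodgeConjecture-24833 --as helper`; THEOREMS ONLY (no definition ∕ instance ∕ notation ∕ named fact ∕ `sorry`); never imports `Cruxes/…/Lines`.
COUNT-NEUTRAL.

`χ` quadratic `≠ 1`, `ψ(y) = χ̃(y)‖y‖⁻¹`, truncation `1[y ∉ 𝔭^b]`.  The domination `|B_n| ≤ C·|disc R|^{-1∕2}` UNIFORMLY IN `n` (needed for dominated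
convergence in (K5) and for the rider `√|disc|·|Fr| ∈ L^∞_loc`) is assembled from:
* §1 `norm_setIntegral_sdiff_extend_mul_normInv_le` — the MODEL ANNULUS `|∫_{𝔭^a ∖ 𝔭^b} χ̃(v)‖v‖⁻¹ dv| ≤ μ(𝒪)` for all `a, b` (unramified: `(1−q⁻¹)μ(𝒪)·|(±1 ∓ 1)∕2|`,
  ★ p857390; ramified: `0` shell by shell, ★ `setIntegral_shell_mul_extend_eq_zero`); hence `|∫_{𝔭^α} 1[v ∉ 𝔭^b] ψ(v) dv| ≤ μ(𝒪)` (`norm_setIntegral_ball_trunc_le`);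
* §2 `setIntegral_ball_rootFactor_trunc_eq` — on the localisation ball of a simple root, `∫_{𝔭^α} 1[a v(d+v) ∉ 𝔭^b] ψ(a v (d+v)) dv = χ̃(ad)‖ad‖⁻¹·∫_{𝔭^α} 1[v ∉ 𝔭^{b−w}]ψ`,
  so its norm is `≤ ‖ad‖⁻¹ μ(𝒪)` (`norm_setIntegral_ball_rootFactor_trunc_le`);
* §3 `norm_setIntegral_trunc_linear_le` — LINEAR cell quadratic `R = r₁(σ − σ₁)`: `|∫_{𝔭^β} 1[R ∉ 𝔭^b]ψ(R)| ≤ ‖r₁‖⁻¹ μ(𝒪) = μ(𝒪)·|disc|^{-1∕2}`;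
* §4 `norm_setIntegral_trunc_elliptic_le` — ELLIPTIC `R = r₂((σ−u)² − Δ)`, `Δ ∉ F²`: `≤ 2‖r₂‖⁻¹‖2‖⁻²(√‖Δ‖)⁻¹ μ(𝒪)` (★ p857429).
[HarishChandra1999AdmissibleDistributions, §7] [LabesseLanglands1979, §2] [Tate1950, §2.5]
HONEST LABEL: HC_CM is proved only modulo the 7 printed citations (2 remaining named inputs: hLiu418 = stmt-HodgeConjecture-24832, h413 =
stmt-HodgeConjecture-24833) until rung 0 closes; count-neutral helper toward (LBU-2⁺)∕(G⁺-b), NOT ★.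

## References
* [HarishChandra1999AdmissibleDistributions] Harish-Chandra (DeBacker–Sally), *Admissible Invariant Distributions on Reductive p-adic Groups* (1999), §7.
* [LabesseLanglands1979] J.-P. Labesse, R. P. Langlands, *L-indistinguishability for SL(2)*, Canad. J. Math. 31 (1979), §2.
* [Tate1950] J. Tate, *Fourier analysis in number fields and Hecke's zeta-functions* (1950), §2.5.
-/

set_option autoImplicit false
set_option linter.dupNamespace false   -- `Summit.HodgeConjecture.HodgeConjecture.…` (D-0017 nested layout; lakefile exemption for Summits)

noncomputable section

open MeasureTheory Measure Filter Topology Set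
open scoped NNReal ENNReal Pointwise
open ValuativeRel
open Literature.NumberTheory.Automorphic Literature.NumberTheory.Automorphic.LocalFieldHaar Literature.NumberTheory.Automorphic.TateDirect
open Literature.NumberTheory.GaloisRepresentations Literature.NumberTheory.GaloisRepresentations.IsNonarchimedeanLocalField
open Summit.HodgeConjecture.HodgeConjecture.Cruxes.H413.K2E3LocalFieldSignCharZetaBalls
open Summit.HodgeConjecture.HodgeConjecture.Cruxes.H413.K2E3LocalFieldQuadraticCharSignWeight
open Summit.HodgeConjecture.HodgeConjecture.Cruxes.H413.K2E3LocalFieldQuadraticCharLocalisation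
open Summit.HodgeConjecture.HodgeConjecture.Cruxes.H413.K2E3LocalFieldQuadraticWeightElliptic
open Summit.HodgeConjecture.HodgeConjecture.Cruxes.H413.K2E3LocalFieldQuadraticWeightEventuallyConst

namespace Summit.HodgeConjecture.HodgeConjecture.Cruxes.H413.K2E3LocalFieldQuadraticWeightBoundLemmas

variable {F : Type*} [Field F] [ValuativeRel F] [TopologicalSpace F] [IsNonarchimedeanLocalField F]
  [MeasurableSpace F] [BorelSpace F] (μ : Measure F) [μ.IsAddHaarMeasure]

/-! ## §1  The model annulus -/

/-- Ramified `χ`: `∫_{𝔭^a ∖ 𝔭^{a+i}} χ̃(v)‖v‖⁻¹ dv = 0` (each shell vanishes). [cite: Tate1950, §2.5] -/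
theorem setIntegral_sdiff_extend_mul_normInv_of_not_isUnramified (χ : QuasiChar F) (hχ2 : ∀ u, χ u * χ u = 1) (hun : ¬ χ.IsUnramified) (a : ℤ) :
    ∀ i : ℕ, ∫ v in primePowBall F a \ primePowBall F (a + i),
      Function.extend ((↑) : Fˣ → F) (fun u => ((χ u : ℂˣ) : ℂ)) 0 v * ((((normAbs F v)⁻¹ : ℝ≥0) : ℝ) : ℂ) ∂μ = 0 := by
  intro i
  induction i with
  | zero => simp
  | succ i ih =>
    rw [sdiff_primePowBall_succ_eq, setIntegral_union (disjoint_sdiff_shell a i) (measurableSet_shell _)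
      ((integrableOn_sign_mul_normInv μ (measurable_extend χ) (norm_extend_le_one χ hχ2) a (a + i + 1)).mono_set fun t ht =>
        ⟨ht.1, fun h => ht.2 (primePowBall_antitone (by omega) h)⟩)
      (integrableOn_sign_mul_normInv μ (measurable_extend χ) (norm_extend_le_one χ hχ2) _ _), ih, zero_add]
    have h := setIntegral_shell_mul_extend_eq_zero μ hun (a + i) (fun v => ((((normAbs F v)⁻¹ : ℝ≥0) : ℝ) : ℂ))
      (fun u hu x => by simp only [map_mul, hu, one_mul])
    simpa only [mul_comm] using h

/-- **THE MODEL ANNULUS IS UNIFORMLY BOUNDED**: `|∫_{𝔭^a ∖ 𝔭^b} χ̃(v)‖v‖⁻¹ dv| ≤ μ(𝒪)` for every quadratic `χ ≠ 1` and all `a, b ∈ ℤ`.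
[cite: Tate1950, §2.5] [cite: LabesseLanglands1979, §2] -/
theorem norm_setIntegral_sdiff_extend_mul_normInv_le (χ : QuasiChar F) (hχ2 : ∀ u, χ u * χ u = 1) (hχ1 : ∃ u, χ u ≠ 1) (a b : ℤ) :
    ‖∫ v in primePowBall F a \ primePowBall F b,
      Function.extend ((↑) : Fˣ → F) (fun u => ((χ u : ℂˣ) : ℂ)) 0 v * ((((normAbs F v)⁻¹ : ℝ≥0) : ℝ) : ℂ) ∂μ‖ ≤ μ.real (primePowBall F 0) := by
  by_cases hab : b ≤ a
  · rw [Set.sdiff_eq_empty.2 (primePowBall_antitone hab), Measure.restrict_empty, integral_zero_measure, norm_zero]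
    exact measureReal_nonneg
  obtain ⟨i, rfl⟩ : ∃ i : ℕ, b = a + i := ⟨(b - a).toNat, by omega⟩
  by_cases hun : χ.IsUnramified
  · obtain ⟨ϖ, _, hϖ⟩ := exists_normAbs_eq_inv (F := F)
    rw [setIntegral_sdiff_sign_mul_normInv μ (measurable_extend χ) (norm_extend_le_one χ hχ2)
      (fun j x hx => extend_eq_neg_one_zpow_of_mem_shell χ hun hχ2 hχ1 hϖ j x hx) a i]
    have hq : ‖(1 - (residueFieldCard F : ℂ)⁻¹)‖ ≤ 1 := by
      have hq1 : (1 : ℝ) ≤ residueFieldCard F := by exact_mod_cast Nat.one_le_iff_ne_zero.2 (residueFieldCard_ne_zero F)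
      have h0 : (0 : ℝ) ≤ 1 - (residueFieldCard F : ℝ)⁻¹ := sub_nonneg.2 (inv_le_one_of_one_le₀ hq1)
      have : (1 - (residueFieldCard F : ℂ)⁻¹) = ((1 - (residueFieldCard F : ℝ)⁻¹ : ℝ) : ℂ) := by push_cast; ring
      rw [this, Complex.norm_real, Real.norm_eq_abs, abs_of_nonneg h0]
      exact sub_le_self _ (inv_nonneg.2 (by positivity))
    have hsign : ‖(((-1 : ℂ) ^ a - (-1) ^ (a + (i : ℤ))) / 2)‖ ≤ 1 := by
      rw [norm_div, Complex.norm_two]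
      refine div_le_one_of_le₀ ((norm_sub_le _ _).trans ?_) zero_le_two
      rw [norm_zpow, norm_zpow, norm_neg, norm_one, one_zpow, one_zpow]; norm_num
    rw [norm_mul, norm_mul, Complex.norm_real, Real.norm_eq_abs, abs_of_nonneg measureReal_nonneg]
    calc _ ≤ 1 * μ.real (primePowBall F 0) * 1 := by gcongr
      _ = _ := by ring
  · rw [setIntegral_sdiff_extend_mul_normInv_of_not_isUnramified μ χ hχ2 hun a i, norm_zero]
    exact measureReal_nonneg

/-- `|∫_{𝔭^α} 1[v ∉ 𝔭^b] χ̃(v)‖v‖⁻¹ dv| ≤ μ(𝒪)`. [cite: Tate1950, §2.5] -/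
theorem norm_setIntegral_ball_trunc_le (χ : QuasiChar F) (hχ2 : ∀ u, χ u * χ u = 1) (hχ1 : ∃ u, χ u ≠ 1) (α b : ℤ) :
    ‖∫ v in primePowBall F α, (primePowBall F b)ᶜ.indicator
      (fun y => Function.extend ((↑) : Fˣ → F) (fun u => ((χ u : ℂˣ) : ℂ)) 0 y * ((((normAbs F y)⁻¹ : ℝ≥0) : ℝ) : ℂ)) v ∂μ‖ ≤ μ.real (primePowBall F 0) := by
  rw [integral_indicator (measurableSet_primePowBall b).compl, Measure.restrict_restrict (measurableSet_primePowBall b).compl,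
    Set.inter_comm, ← Set.sdiff_eq]
  exact norm_setIntegral_sdiff_extend_mul_normInv_le μ χ hχ2 hχ1 α b

/-! ## §2  The localised ball -/

omit [μ.IsAddHaarMeasure] in
/-- **The localised ball, exactly**: on the localisation ball `𝔭^α` of a simple root (`χ̃(1+t) = 1` on `𝔭^e`, `e ≥ 1`, `d ≠ 0`, `‖ad‖ = (q⁻¹)^w`,
`(q⁻¹)^α ≤ ‖d‖(q⁻¹)^e`): `∫_{𝔭^α} 1[a v(d+v) ∉ 𝔭^b] ψ(a v(d+v)) dv = χ̃(ad)‖ad‖⁻¹ · ∫_{𝔭^α} 1[v ∉ 𝔭^{b−w}] ψ(v) dv`.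
[cite: HarishChandra1999AdmissibleDistributions, §7] -/
theorem setIntegral_ball_rootFactor_trunc_eq (χ : QuasiChar F) {e : ℕ} (he : 1 ≤ e)
    (hce : ∀ t ∈ primePowBall F (e : ℤ), Function.extend ((↑) : Fˣ → F) (fun u => ((χ u : ℂˣ) : ℂ)) 0 (1 + t) = 1)
    {a d : F} (hd : d ≠ 0) {w : ℤ} (hw : normAbs F (a * d) = ((residueFieldCard F : ℝ≥0)⁻¹) ^ w)
    {α : ℤ} (hα : ((residueFieldCard F : ℝ≥0)⁻¹) ^ α ≤ normAbs F d * ((residueFieldCard F : ℝ≥0)⁻¹) ^ (e : ℤ)) (b : ℤ) :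
    ∫ v in primePowBall F α, (primePowBall F b)ᶜ.indicator
        (fun y => Function.extend ((↑) : Fˣ → F) (fun u => ((χ u : ℂˣ) : ℂ)) 0 y * ((((normAbs F y)⁻¹ : ℝ≥0) : ℝ) : ℂ)) (a * v * (d + v)) ∂μ =
      (Function.extend ((↑) : Fˣ → F) (fun u => ((χ u : ℂˣ) : ℂ)) 0 (a * d) * ((((normAbs F (a * d))⁻¹ : ℝ≥0) : ℝ) : ℂ)) *
        ∫ v in primePowBall F α, (primePowBall F (b - w))ᶜ.indicator
          (fun v => Function.extend ((↑) : Fˣ → F) (fun u => ((χ u : ℂˣ) : ℂ)) 0 v * ((((normAbs F v)⁻¹ : ℝ≥0) : ℝ) : ℂ)) v ∂μ := by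
  rw [← integral_const_mul]
  refine setIntegral_congr_fun (measurableSet_primePowBall α) fun v hv => ?_
  have hv' : normAbs F v ≤ normAbs F d * ((residueFieldCard F : ℝ≥0)⁻¹) ^ (e : ℤ) := (mem_primePowBall_iff.1 hv).trans hα
  have hmem : a * v * (d + v) ∈ (primePowBall F b)ᶜ ↔ v ∈ (primePowBall F (b - w))ᶜ := by
    rw [Set.mem_compl_iff, Set.mem_compl_iff, rootFactor_mem_primePowBall_iff he hd hw hv']
  by_cases h : v ∈ (primePowBall F (b - w))ᶜ
  · rw [indicator_of_mem (hmem.2 h), indicator_of_mem h, extend_rootFactor_eq χ hce a hd hv', normAbs_rootFactor_eq he a hd hv',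
      mul_inv, NNReal.coe_mul, Complex.ofReal_mul]
    ring
  · rw [indicator_of_notMem (fun h' => h (hmem.1 h')), indicator_of_notMem h, mul_zero]

/-- **The localised ball is bounded by `‖ad‖⁻¹ μ(𝒪)`**, uniformly in the truncation. [cite: HarishChandra1999AdmissibleDistributions, §7] -/
theorem norm_setIntegral_ball_rootFactor_trunc_le (χ : QuasiChar F) (hχ2 : ∀ u, χ u * χ u = 1) (hχ1 : ∃ u, χ u ≠ 1) {e : ℕ} (he : 1 ≤ e)
    (hce : ∀ t ∈ primePowBall F (e : ℤ), Function.extend ((↑) : Fˣ → F) (fun u => ((χ u : ℂˣ) : ℂ)) 0 (1 + t) = 1)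
    {a d : F} (hd : d ≠ 0) {w : ℤ} (hw : normAbs F (a * d) = ((residueFieldCard F : ℝ≥0)⁻¹) ^ w)
    {α : ℤ} (hα : ((residueFieldCard F : ℝ≥0)⁻¹) ^ α ≤ normAbs F d * ((residueFieldCard F : ℝ≥0)⁻¹) ^ (e : ℤ)) (b : ℤ) :
    ‖∫ v in primePowBall F α, (primePowBall F b)ᶜ.indicator
        (fun y => Function.extend ((↑) : Fˣ → F) (fun u => ((χ u : ℂˣ) : ℂ)) 0 y * ((((normAbs F y)⁻¹ : ℝ≥0) : ℝ) : ℂ)) (a * v * (d + v)) ∂μ‖ ≤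
      ((normAbs F (a * d))⁻¹ : ℝ) * μ.real (primePowBall F 0) := by
  rw [setIntegral_ball_rootFactor_trunc_eq μ χ he hce hd hw hα b, norm_mul, norm_mul, Complex.norm_real, Real.norm_eq_abs,
    abs_of_nonneg (NNReal.coe_nonneg _), NNReal.coe_inv]
  calc _ ≤ 1 * ((normAbs F (a * d) : ℝ))⁻¹ * μ.real (primePowBall F 0) := by
        gcongr
        · exact norm_extend_le_one χ hχ2 _
        · exact norm_setIntegral_ball_trunc_le μ χ hχ2 hχ1 α _
    _ = _ := by ring

/-! ## §3  The linear cell quadratic -/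

/-- **LINEAR CASE**: for `r₁ ≠ 0` and every `σ₁`, `b`, `β`: `|∫_{𝔭^β} 1[r₁(σ−σ₁) ∉ 𝔭^b] ψ(r₁(σ−σ₁)) dσ| ≤ ‖r₁‖⁻¹ μ(𝒪)`.
[cite: HarishChandra1999AdmissibleDistributions, §7] [cite: LabesseLanglands1979, §2] -/
theorem norm_setIntegral_trunc_linear_le (χ : QuasiChar F) (hχ2 : ∀ u, χ u * χ u = 1) (hχ1 : ∃ u, χ u ≠ 1) {r₁ : F} (hr₁ : r₁ ≠ 0) (σ₁ : F) (b β : ℤ) :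
    ‖∫ σ in primePowBall F β, (primePowBall F b)ᶜ.indicator
        (fun y => Function.extend ((↑) : Fˣ → F) (fun u => ((χ u : ℂˣ) : ℂ)) 0 y * ((((normAbs F y)⁻¹ : ℝ≥0) : ℝ) : ℂ)) (r₁ * (σ - σ₁)) ∂μ‖ ≤
      ((normAbs F r₁)⁻¹ : ℝ) * μ.real (primePowBall F 0) := by
  haveI : T2Space F := (isLocalField F).toT2Space
  obtain ⟨w, hw⟩ := exists_normAbs_eq_inv_zpow hr₁
  have hr₁0 : 0 < (normAbs F r₁ : ℝ) := by exact_mod_cast pos_iff_ne_zero.2 ((map_ne_zero (normAbs F)).2 hr₁)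
  -- pointwise: `1[r₁ v ∉ 𝔭^b] ψ(r₁ v) = χ̃(r₁)‖r₁‖⁻¹ · 1[v ∉ 𝔭^{b−w}] ψ(v)`
  have hpt : ∀ v : F, (primePowBall F b)ᶜ.indicator
      (fun y => Function.extend ((↑) : Fˣ → F) (fun u => ((χ u : ℂˣ) : ℂ)) 0 y * ((((normAbs F y)⁻¹ : ℝ≥0) : ℝ) : ℂ)) (r₁ * v) =
      (Function.extend ((↑) : Fˣ → F) (fun u => ((χ u : ℂˣ) : ℂ)) 0 r₁ * ((((normAbs F r₁)⁻¹ : ℝ≥0) : ℝ) : ℂ)) *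
        (primePowBall F (b - w))ᶜ.indicator
          (fun v => Function.extend ((↑) : Fˣ → F) (fun u => ((χ u : ℂˣ) : ℂ)) 0 v * ((((normAbs F v)⁻¹ : ℝ≥0) : ℝ) : ℂ)) v := by
    intro v
    have hmem : r₁ * v ∈ (primePowBall F b)ᶜ ↔ v ∈ (primePowBall F (b - w))ᶜ := by
      rw [Set.mem_compl_iff, Set.mem_compl_iff, mul_mem_primePowBall_iff hw]
    by_cases h : v ∈ (primePowBall F (b - w))ᶜ
    · have hv0 : v ≠ 0 := fun h0 => h (h0 ▸ zero_mem_primePowBall _)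
      rw [indicator_of_mem (hmem.2 h), indicator_of_mem h, extend_mul χ hr₁ hv0, map_mul, mul_inv, NNReal.coe_mul, Complex.ofReal_mul]
      ring
    · rw [indicator_of_notMem (fun h' => h (hmem.1 h')), indicator_of_notMem h, mul_zero]
  -- translate `σ = σ₁ + v`
  have htrans : ∫ σ in primePowBall F β, (primePowBall F b)ᶜ.indicator
      (fun y => Function.extend ((↑) : Fˣ → F) (fun u => ((χ u : ℂˣ) : ℂ)) 0 y * ((((normAbs F y)⁻¹ : ℝ≥0) : ℝ) : ℂ)) (r₁ * (σ - σ₁)) ∂μ =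
      ∫ v, (primePowBall F β).indicator (fun _ => (1 : ℂ)) (σ₁ + v) *
        ((Function.extend ((↑) : Fˣ → F) (fun u => ((χ u : ℂˣ) : ℂ)) 0 r₁ * ((((normAbs F r₁)⁻¹ : ℝ≥0) : ℝ) : ℂ)) *
          (primePowBall F (b - w))ᶜ.indicator
            (fun v => Function.extend ((↑) : Fˣ → F) (fun u => ((χ u : ℂˣ) : ℂ)) 0 v * ((((normAbs F v)⁻¹ : ℝ≥0) : ℝ) : ℂ)) v) ∂μ := by
    rw [← integral_indicator (measurableSet_primePowBall β),
      ← integral_add_left_eq_self (μ := μ) ((primePowBall F β).indicator fun σ => (primePowBall F b)ᶜ.indicator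
        (fun y => Function.extend ((↑) : Fˣ → F) (fun u => ((χ u : ℂˣ) : ℂ)) 0 y * ((((normAbs F y)⁻¹ : ℝ≥0) : ℝ) : ℂ)) (r₁ * (σ - σ₁))) σ₁]
    refine integral_congr_ae (Eventually.of_forall fun v => ?_)
    beta_reduce
    by_cases hs : σ₁ + v ∈ primePowBall F β
    · rw [indicator_of_mem hs, indicator_of_mem hs, one_mul, add_sub_cancel_left, hpt v]
    · rw [indicator_of_notMem hs, indicator_of_notMem hs, zero_mul]
  rw [htrans]
  have hCnorm : ‖Function.extend ((↑) : Fˣ → F) (fun u => ((χ u : ℂˣ) : ℂ)) 0 r₁ * ((((normAbs F r₁)⁻¹ : ℝ≥0) : ℝ) : ℂ)‖ ≤ ((normAbs F r₁)⁻¹ : ℝ) := by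
    rw [norm_mul, Complex.norm_real, Real.norm_eq_abs, abs_of_nonneg (NNReal.coe_nonneg _), NNReal.coe_inv]
    calc _ ≤ 1 * ((normAbs F r₁ : ℝ))⁻¹ := by gcongr; exact norm_extend_le_one χ hχ2 _
      _ = _ := one_mul _
  by_cases hσ₁ : σ₁ ∈ primePowBall F β
  · -- the ball `σ₁ + 𝔭^β` IS `𝔭^β`
    have hind : ∀ v : F, (primePowBall F β).indicator (fun _ => (1 : ℂ)) (σ₁ + v) *
        ((Function.extend ((↑) : Fˣ → F) (fun u => ((χ u : ℂˣ) : ℂ)) 0 r₁ * ((((normAbs F r₁)⁻¹ : ℝ≥0) : ℝ) : ℂ)) *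
          (primePowBall F (b - w))ᶜ.indicator
            (fun v => Function.extend ((↑) : Fˣ → F) (fun u => ((χ u : ℂˣ) : ℂ)) 0 v * ((((normAbs F v)⁻¹ : ℝ≥0) : ℝ) : ℂ)) v) =
        (primePowBall F β).indicator (fun v => (Function.extend ((↑) : Fˣ → F) (fun u => ((χ u : ℂˣ) : ℂ)) 0 r₁ * ((((normAbs F r₁)⁻¹ : ℝ≥0) : ℝ) : ℂ)) *
          (primePowBall F (b - w))ᶜ.indicator
            (fun v => Function.extend ((↑) : Fˣ → F) (fun u => ((χ u : ℂˣ) : ℂ)) 0 v * ((((normAbs F v)⁻¹ : ℝ≥0) : ℝ) : ℂ)) v) v := by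
      intro v
      by_cases hv : v ∈ primePowBall F β
      · rw [indicator_of_mem ((add_mem_primePowBall_iff_of_mem le_rfl hv).2 hσ₁), indicator_of_mem hv, one_mul]
      · have hsv : σ₁ + v ∉ primePowBall F β := fun h => hv (by
          have := add_mem_primePowBall (neg_mem_primePowBall hσ₁) h
          rwa [neg_add_cancel_left] at this)
        rw [indicator_of_notMem hsv, indicator_of_notMem hv, zero_mul]
    simp_rw [hind]
    rw [integral_indicator (measurableSet_primePowBall β), integral_const_mul, norm_mul]
    exact mul_le_mul hCnorm (norm_setIntegral_ball_trunc_le μ χ hχ2 hχ1 β _) (norm_nonneg _) (by positivity)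
  · -- the ball `σ₁ + 𝔭^β` is DISJOINT from `𝔭^β`'s centre: on it `‖v‖ = ‖σ₁‖ > (q⁻¹)^β`
    have hσ₁n : ((residueFieldCard F : ℝ≥0)⁻¹) ^ β < normAbs F σ₁ := not_le.1 (fun h => hσ₁ (mem_primePowBall_iff.2 h))
    have hσ₁0 : 0 < normAbs F σ₁ := lt_of_le_of_lt bot_le hσ₁n
    set T : Set F := (fun v => σ₁ + v) ⁻¹' primePowBall F β with hT
    have hTm : MeasurableSet T := (measurableSet_primePowBall β).preimage (measurable_const_add σ₁)
    have hTμ : μ T = μ (primePowBall F β) := measure_preimage_add μ σ₁ _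
    have hnormv : ∀ v ∈ T, normAbs F v = normAbs F σ₁ := by
      intro v hv
      have h1 : normAbs F (σ₁ + v) < normAbs F σ₁ := (mem_primePowBall_iff.1 hv).trans_lt hσ₁n
      have : v = (σ₁ + v) + (-σ₁) := by ring
      rw [this, ← normAbs_neg σ₁]
      rw [← normAbs_neg σ₁] at h1
      rw [add_comm]
      exact normAbs_add_eq_of_lt h1
    have hind : ∀ v : F, (primePowBall F β).indicator (fun _ => (1 : ℂ)) (σ₁ + v) *
        ((Function.extend ((↑) : Fˣ → F) (fun u => ((χ u : ℂˣ) : ℂ)) 0 r₁ * ((((normAbs F r₁)⁻¹ : ℝ≥0) : ℝ) : ℂ)) *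
          (primePowBall F (b - w))ᶜ.indicator
            (fun v => Function.extend ((↑) : Fˣ → F) (fun u => ((χ u : ℂˣ) : ℂ)) 0 v * ((((normAbs F v)⁻¹ : ℝ≥0) : ℝ) : ℂ)) v) =
        T.indicator (fun v => (Function.extend ((↑) : Fˣ → F) (fun u => ((χ u : ℂˣ) : ℂ)) 0 r₁ * ((((normAbs F r₁)⁻¹ : ℝ≥0) : ℝ) : ℂ)) *
          (primePowBall F (b - w))ᶜ.indicator
            (fun v => Function.extend ((↑) : Fˣ → F) (fun u => ((χ u : ℂˣ) : ℂ)) 0 v * ((((normAbs F v)⁻¹ : ℝ≥0) : ℝ) : ℂ)) v) v := by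
      intro v
      by_cases hv : v ∈ T
      · rw [indicator_of_mem (show σ₁ + v ∈ primePowBall F β from hv), indicator_of_mem hv, one_mul]
      · rw [indicator_of_notMem (show σ₁ + v ∉ primePowBall F β from hv), indicator_of_notMem hv, zero_mul]
    simp_rw [hind]
    rw [integral_indicator hTm]
    have hbd : ∀ v ∈ T, ‖(Function.extend ((↑) : Fˣ → F) (fun u => ((χ u : ℂˣ) : ℂ)) 0 r₁ * ((((normAbs F r₁)⁻¹ : ℝ≥0) : ℝ) : ℂ)) *
        (primePowBall F (b - w))ᶜ.indicator
          (fun v => Function.extend ((↑) : Fˣ → F) (fun u => ((χ u : ℂˣ) : ℂ)) 0 v * ((((normAbs F v)⁻¹ : ℝ≥0) : ℝ) : ℂ)) v‖ ≤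
        ((normAbs F r₁)⁻¹ : ℝ) * ((normAbs F σ₁)⁻¹ : ℝ) := by
      intro v hv
      rw [norm_mul]
      refine mul_le_mul hCnorm ?_ (norm_nonneg _) (by positivity)
      refine (norm_indicator_le_norm_self _ _).trans ?_
      rw [norm_mul, Complex.norm_real, Real.norm_eq_abs, abs_of_nonneg (NNReal.coe_nonneg _), NNReal.coe_inv, hnormv v hv]
      calc _ ≤ 1 * ((normAbs F σ₁ : ℝ))⁻¹ := by gcongr; exact norm_extend_le_one χ hχ2 _
        _ = _ := one_mul _
    have hTfin : μ T < ⊤ := by rw [hTμ]; exact (isCompact_primePowBall β).measure_lt_top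
    refine (norm_setIntegral_le_of_norm_le_const hTfin hbd).trans ?_
    rw [measureReal_def, hTμ, ← measureReal_def, measureReal_primePowBall, mul_assoc]
    refine mul_le_mul_of_nonneg_left ?_ (by positivity)
    -- `‖σ₁‖⁻¹ (q⁻¹)^β μ(𝒪) ≤ μ(𝒪)`
    have hle : ((residueFieldCard F : ℝ)⁻¹) ^ β ≤ (normAbs F σ₁ : ℝ) := by
      have := hσ₁n.le
      rw [← NNReal.coe_le_coe, NNReal.coe_zpow, NNReal.coe_inv, NNReal.coe_natCast] at this
      exact this
    have hσpos : (0 : ℝ) < normAbs F σ₁ := by exact_mod_cast hσ₁0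
    calc ((normAbs F σ₁ : ℝ))⁻¹ * (((residueFieldCard F : ℝ)⁻¹) ^ β * μ.real (primePowBall F 0))
        = (((normAbs F σ₁ : ℝ))⁻¹ * ((residueFieldCard F : ℝ)⁻¹) ^ β) * μ.real (primePowBall F 0) := by ring
      _ ≤ 1 * μ.real (primePowBall F 0) := by
          refine mul_le_mul_of_nonneg_right ?_ measureReal_nonneg
          rw [inv_mul_le_iff₀ hσpos, mul_one]
          exact hle
      _ = μ.real (primePowBall F 0) := one_mul _

/-! ## §4  The elliptic cell quadratic -/

/-- **ELLIPTIC CASE**: for `r₂ ≠ 0`, `Δ ∉ F²`, every `u`, `b`, `β` (`char F ≠ 2`):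
`|∫_{𝔭^β} 1[R ∉ 𝔭^b] ψ(R) dσ| ≤ 2‖r₂‖⁻¹‖2‖⁻²(√‖Δ‖)⁻¹ μ(𝒪)`, `R(σ) = r₂((σ−u)² − Δ)`.
[cite: HarishChandra1999AdmissibleDistributions, §7] [cite: LabesseLanglands1979, §2] -/
theorem norm_setIntegral_trunc_elliptic_le (h2 : (2 : F) ≠ 0) (χ : QuasiChar F) (hχ2 : ∀ u, χ u * χ u = 1) {r₂ Δ : F} (hr₂ : r₂ ≠ 0)
    (hΔ : ¬ IsSquare Δ) (u : F) (b β : ℤ) :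
    ‖∫ σ in primePowBall F β, (primePowBall F b)ᶜ.indicator
        (fun y => Function.extend ((↑) : Fˣ → F) (fun u => ((χ u : ℂˣ) : ℂ)) 0 y * ((((normAbs F y)⁻¹ : ℝ≥0) : ℝ) : ℂ)) (r₂ * ((σ - u) ^ 2 - Δ)) ∂μ‖ ≤
      2 * (((normAbs F r₂)⁻¹ * ((normAbs F 2)⁻¹) ^ 2 * (NNReal.sqrt (normAbs F Δ))⁻¹ : ℝ≥0) : ℝ) * μ.real (primePowBall F 0) := by
  have hfinO : μ (primePowBall F 0) ≠ ⊤ := (isCompact_primePowBall 0).measure_lt_top.ne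
  -- pointwise norm bound by `‖R σ‖⁻¹`
  have hpt : ∀ σ : F, ENNReal.ofReal ‖(primePowBall F b)ᶜ.indicator
      (fun y => Function.extend ((↑) : Fˣ → F) (fun u => ((χ u : ℂˣ) : ℂ)) 0 y * ((((normAbs F y)⁻¹ : ℝ≥0) : ℝ) : ℂ)) (r₂ * ((σ - u) ^ 2 - Δ))‖ ≤
      (((normAbs F (r₂ * ((σ - u) ^ 2 - Δ)))⁻¹ : ℝ≥0) : ℝ≥0∞) := by
    intro σ
    rw [← ENNReal.ofReal_coe_nnreal]
    refine ENNReal.ofReal_le_ofReal ((norm_indicator_le_norm_self _ _).trans ?_)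
    rw [norm_mul, Complex.norm_real, Real.norm_eq_abs, abs_of_nonneg (NNReal.coe_nonneg _), NNReal.coe_inv]
    calc _ ≤ 1 * ((normAbs F (r₂ * ((σ - u) ^ 2 - Δ)) : ℝ))⁻¹ := by gcongr; exact norm_extend_le_one χ hχ2 _
      _ = _ := one_mul _
  have hlin := lintegral_normAbs_inv_quadratic_le_of_not_isSquare μ h2 hr₂ hΔ u
  have hne : 2 * ((((normAbs F r₂)⁻¹ * ((normAbs F 2)⁻¹) ^ 2 * (NNReal.sqrt (normAbs F Δ))⁻¹ : ℝ≥0) : ℝ≥0∞)) * μ (primePowBall F 0) ≠ ⊤ :=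
    ENNReal.mul_ne_top (ENNReal.mul_ne_top (by norm_num) ENNReal.coe_ne_top) hfinO
  refine (norm_integral_le_lintegral_norm _).trans ?_
  have hmono : ∫⁻ σ in primePowBall F β, ENNReal.ofReal ‖(primePowBall F b)ᶜ.indicator
      (fun y => Function.extend ((↑) : Fˣ → F) (fun u => ((χ u : ℂˣ) : ℂ)) 0 y * ((((normAbs F y)⁻¹ : ℝ≥0) : ℝ) : ℂ)) (r₂ * ((σ - u) ^ 2 - Δ))‖ ∂μ ≤
      2 * ((((normAbs F r₂)⁻¹ * ((normAbs F 2)⁻¹) ^ 2 * (NNReal.sqrt (normAbs F Δ))⁻¹ : ℝ≥0) : ℝ≥0∞)) * μ (primePowBall F 0) :=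
    ((lintegral_mono fun σ => hpt σ).trans (lintegral_mono' Measure.restrict_le_self le_rfl)).trans hlin
  refine (ENNReal.toReal_mono hne hmono).trans ?_
  rw [ENNReal.toReal_mul, ENNReal.toReal_mul, ← measureReal_def]
  norm_num

end Summit.HodgeConjecture.HodgeConjecture.Cruxes.H413.K2E3LocalFieldQuadraticWeightBoundLemmas

end
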